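import Literature.AlgebraicTopology.CharacteristicClasses.ProjectiveBundle
import Literature.AlgebraicTopology.CharacteristicClasses.ProjectiveLine
import HarnessLib

/-!
# The splitting `q*ξ = λ_ξ ⊕ σ_ξ` over the projective bundle: the two vector bundle cores

Topic `Literature/AlgebraicTopology/CharacteristicClasses`. D. Husemoller, *Fibre Bundles*, Ch. 17
§2 and Prop. 5.2 (proof of the splitting principle, Thm. 5.4): for a complex vector bundle `ξ`
over `B` with projective bundle `q : E(Pξ) → B`, "a point in `E(Pξ)` is a line `L` in the fibre
of `ξ` over `q(L)`"; the **line subbundle** `λ_ξ ⊆ q*ξ` consists of the pairs `(L, x)` with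
`x ∈ L`, and `q*(ξ) = λ_ξ ⊕ σ_ξ` for a complementary subbundle `σ_ξ` (Husemoller takes the
orthogonal complement for a Hermitian metric; abstractly `σ_ξ ≅ q*ξ / λ_ξ`).

This file constructs, for the tree's `ComplexVectorBundle` `E` over `B` (model fibre `F = E.F`,
`n = rank`) and its projective bundle `P(E) = E.Proj` (the sibling `ProjectiveBundle.lean`, fibres
`ℙ ℂ (E.E b)`), the two bundles as Mathlib `VectorBundleCore`s over `P(E)` by explicit cocycles:

* charts are indexed by **adapted frames** `α = (i, A)`: a canonical trivialisation
  `e_i = trivializationAt i` of `E` followed by a linear automorphism `A` of `F`; the frame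
  cocycle is `G_{αβ}(b) = A' ∘ g_{ij}(b) ∘ A⁻¹` (`frameChange`), and the line of a point
  `m = (b, ℓ) ∈ P(E)` in the frame `α` is `ℓ_α = ℙ(A ∘ e_i(b)) ℓ ∈ ℙ F` (`lineIn`); the chart
  domain of `α` is `{m | b ∈ U_i, φ₀(ℓ_α) ≠ 0}` for ONE fixed coordinate functional `φ₀` of a
  basis of `F` (every line is moved into this chart by a coordinate swap `A`), with normalised
  representative `v_α(m) ∈ F`, `φ₀(v_α) = 1` (`lineRep`);
* `lineCore E k₀` — the **line subbundle `λ`**, model fibre `ℂ`, cocycle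
  `c ↦ φ₀(G_{αβ} v_α) c`;
* `quotCore E k₀` — the **quotient bundle `σ = q*E/λ`**, model fibre `F' = ker φ₀` (dimension
  `n - 1`), cocycle `y ↦ G_{αβ} y - φ₀(G_{αβ} y) v_β` (the map induced by `G_{αβ}` on `F/ℓ`, read in
  the complements `ker φ₀` of `ℓ_α`, `ℓ_β`);
* `lineBundle`, `quotBundle` — the corresponding `ComplexVectorBundle`s over `P(E)`, of ranks
  `1` and `rank E - 1`; `instT2SpaceProj` — `P(E)` is Hausdorff for `B` Hausdorff.

The identification `q*E ≅ λ ⊕ σ` (which needs a metric to embed `σ` as a complement) is the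
sequel. Everything is proved; no named facts.

## References

* [HusemollerFibreBundles1994] D. Husemoller, *Fibre Bundles*, 3rd ed., GTM 20 (1994), Ch. 17 §2
  (2.1)–(2.4), §5 Prop. 5.2, Thm. 5.4.
-/

noncomputable section

open Bundle Function Set Filter Topology
open scoped LinearAlgebra.Projectivization

namespace Literature.AlgebraicTopology.CharacteristicClasses

namespace ComplexVectorBundle

variable {B : Type} [TopologicalSpace B]

/-- The fibres of a complex vector bundle are additive groups (negation `v ↦ (-1) • v`,
`Module.addCommMonoidToAddCommGroup`); needed to form their projective spaces. A SCOPED instance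
(`open ComplexVectorBundle` to use it): for bundles whose fibres already carry an `AddCommGroup`
structure (e.g. `ofCore`) it is only propositionally equal to that one. [folklore] -/
scoped instance instAddCommGroupFiber (E : ComplexVectorBundle.{0, 0} B) (b : B) :
    AddCommGroup (E.E b) :=
  Module.addCommMonoidToAddCommGroup ℂ

/-- **The projective bundle `P(E)`** of a complex vector bundle — the total space of the bundle of
projective spaces `ℙ(E_b)` of the fibres (Husemoller Ch. 17 Def. 2.1; topology and local
triviality from `ProjectiveBundle.lean`). [cite: HusemollerFibreBundles1994, Ch. 17 Def. 2.1] -/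
abbrev Proj (E : ComplexVectorBundle.{0, 0} B) : Type :=
  TotalSpace (ℙ ℂ E.F) fun b ↦ ℙ ℂ (E.E b)

variable (E : ComplexVectorBundle.{0, 0} B)

/-- `P(E)` is Hausdorff when `B` is: points in different fibres are separated by `q`, points in
one fibre by a local trivialisation (the fibre `ℙ F` is Hausdorff). [cite: HusemollerFibreBundles1994, Ch. 17 (2.4)] -/
instance instT2SpaceProj [T2Space B] : T2Space E.Proj := by
  haveI : T2Space (ℙ ℂ E.F) := t2Space_of_finiteDimensional ℂ E.F
  constructor
  intro p q hpq
  by_cases h : p.proj = q.proj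
  · let e := trivializationAt (ℙ ℂ E.F) (fun b ↦ ℙ ℂ (E.E b)) p.proj
    have hp : p ∈ e.source := FiberBundle.mem_trivializationAt_proj_source
    have hq : q ∈ e.source := by
      rw [e.mem_source, ← h]
      exact FiberBundle.mem_baseSet_trivializationAt (ℙ ℂ E.F) (fun b ↦ ℙ ℂ (E.E b)) p.proj
    have hne : e p ≠ e q := fun heq ↦ hpq (e.injOn hp hq heq)
    obtain ⟨u', v', hu', hv', hpu', hqv', huv'⟩ := t2_separation hne
    refine ⟨e.source ∩ e ⁻¹' u', e.source ∩ e ⁻¹' v',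
      e.continuousOn.isOpen_inter_preimage e.open_source hu',
      e.continuousOn.isOpen_inter_preimage e.open_source hv', ⟨hp, hpu'⟩, ⟨hq, hqv'⟩, ?_⟩
    exact (huv'.preimage e).mono Set.inter_subset_right Set.inter_subset_right
  · exact separated_by_continuous (FiberBundle.continuous_proj (ℙ ℂ E.F) (fun b ↦ ℙ ℂ (E.E b))) h

/-- The projection `q : P(E) → B` as a continuous map. [cite: HusemollerFibreBundles1994, Ch. 17 Def. 2.1] -/
def projMap : C(E.Proj, B) := ⟨TotalSpace.proj, continuous_projProj ℂ E.F E.E⟩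

/-- `q` is the bundle projection. [folklore] -/
@[simp]
theorem projMap_apply (m : E.Proj) : E.projMap m = m.proj := rfl

/-! ### Adapted frames -/

/-- The canonical local trivialisations `e_i`, `i ∈ B`, of `E`. [folklore] -/
abbrev triv (i : B) : Trivialization E.F (π E.F E.E) := trivializationAt E.F E.E i

/-- Index of the **adapted frames**: a canonical trivialisation followed by a linear automorphism
of the model fibre. [folklore] -/
abbrev FrameIndex : Type := B × (E.F ≃L[ℂ] E.F)

/-- The frame `E_b ≃L F` of `α = (i, A)` at `b`: `A ∘ e_i(b)` (total in `b`; meaningful on the base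
set of `e_i`). [folklore] -/
def adaptedFrame (α : E.FrameIndex) (b : B) : E.E b ≃L[ℂ] E.F :=
  (linEquivAt ℂ E.F E.E (E.triv α.1) b).trans α.2

/-- The **frame cocycle** `G_{αβ}(b) = A' ∘ g_{ij}(b) ∘ A⁻¹`. [cite: HusemollerFibreBundles1994, Ch. 5 §3 (transition functions)] -/
def frameChange (α β : E.FrameIndex) (b : B) : E.F ≃L[ℂ] E.F :=
  α.2.symm.trans ((Trivialization.coordChangeL ℂ (E.triv α.1) (E.triv β.1) b).trans β.2)

variable {E}

/-- Changing frames is applying the frame cocycle. [folklore] -/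
theorem adaptedFrame_symm_apply {α β : E.FrameIndex} {b : B}
    (hb : b ∈ (E.triv α.1).baseSet ∩ (E.triv β.1).baseSet) (x : E.F) :
    E.adaptedFrame β b ((E.adaptedFrame α b).symm x) = E.frameChange α β b x := by
  simp only [adaptedFrame, frameChange, ContinuousLinearEquiv.trans_apply,
    ContinuousLinearEquiv.symm_trans_apply]
  rw [linEquivAt_symm_trans _ _ hb]

/-- `G_{αα} = 1` on the chart. [folklore] -/
theorem frameChange_self {α : E.FrameIndex} {b : B} (hb : b ∈ (E.triv α.1).baseSet) (x : E.F) :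
    E.frameChange α α b x = x := by
  rw [← adaptedFrame_symm_apply ⟨hb, hb⟩, ContinuousLinearEquiv.apply_symm_apply]

/-- The cocycle identity `G_{βγ} G_{αβ} = G_{αγ}` on triple overlaps. [folklore] -/
theorem frameChange_comp {α β γ : E.FrameIndex} {b : B} (hα : b ∈ (E.triv α.1).baseSet)
    (hβ : b ∈ (E.triv β.1).baseSet) (hγ : b ∈ (E.triv γ.1).baseSet) (x : E.F) :
    E.frameChange β γ b (E.frameChange α β b x) = E.frameChange α γ b x := by
  rw [← adaptedFrame_symm_apply ⟨hα, hβ⟩, ← adaptedFrame_symm_apply ⟨hβ, hγ⟩,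
    ContinuousLinearEquiv.symm_apply_apply, adaptedFrame_symm_apply ⟨hα, hγ⟩]

/-- The frame cocycle is continuous (in operator norm) on overlaps. [folklore] -/
theorem continuousOn_frameChange (α β : E.FrameIndex) :
    ContinuousOn (fun b ↦ (E.frameChange α β b : E.F →L[ℂ] E.F))
      ((E.triv α.1).baseSet ∩ (E.triv β.1).baseSet) := by
  have h := continuousOn_coordChange ℂ (E.triv α.1) (E.triv β.1)
  have : (fun b ↦ (E.frameChange α β b : E.F →L[ℂ] E.F)) = fun b ↦
      ((β.2 : E.F →L[ℂ] E.F).comp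
        (Trivialization.coordChangeL ℂ (E.triv α.1) (E.triv β.1) b : E.F →L[ℂ] E.F)).comp
        (α.2.symm : E.F →L[ℂ] E.F) := by
    funext b
    ext x
    rfl
  rw [this]
  exact ((continuousOn_const.clm_comp h).clm_comp continuousOn_const)

variable (E)

/-- **The line of a point of `P(E)` in the frame `α`**: `ℓ_α(b, ℓ) = ℙ(A ∘ e_i(b)) ℓ ∈ ℙ F`.
[cite: HusemollerFibreBundles1994, Ch. 17 Def. 2.1] -/
def lineIn (α : E.FrameIndex) (m : E.Proj) : ℙ ℂ E.F :=
  Projectivization.map ((E.adaptedFrame α m.proj : E.E m.proj →L[ℂ] E.F) : E.E m.proj →ₗ[ℂ] E.F)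
    (E.adaptedFrame α m.proj).injective m.2

variable {E}

/-- Change of frame for lines: `ℓ_β = ℙ(G_{αβ}) ℓ_α`. [folklore] -/
theorem lineIn_eq_map {α β : E.FrameIndex} {m : E.Proj}
    (hb : m.proj ∈ (E.triv α.1).baseSet ∩ (E.triv β.1).baseSet) :
    E.lineIn β m = Projectivization.map ((E.frameChange α β m.proj : E.F →L[ℂ] E.F) : E.F →ₗ[ℂ] E.F)
      (E.frameChange α β m.proj).injective (E.lineIn α m) := by
  obtain ⟨b, ℓ⟩ := m
  simp only [lineIn]
  induction ℓ using Projectivization.ind with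
  | h v hv =>
    simp only [Projectivization.map_mk]
    congr 1
    change E.adaptedFrame β b v = E.frameChange α β b (E.adaptedFrame α b v)
    rw [← adaptedFrame_symm_apply hb, ContinuousLinearEquiv.symm_apply_apply]

/-- In the frame `(i, A)` the line is `ℙ(A)` of the projectivised trivialisation `e_i`. [folklore] -/
theorem lineIn_eq_homeomorph (α : E.FrameIndex) (m : E.Proj) :
    E.lineIn α m = homeomorphOfContinuousLinearEquiv α.2
      (projTrivialization ℂ E.F E.E (E.triv α.1) m).2 := by
  obtain ⟨b, ℓ⟩ := m
  induction ℓ using Projectivization.ind with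
  | h v hv => rfl

/-- `m ↦ ℓ_α(m)` is continuous over the chart `U_i` of `B`. [folklore] -/
theorem continuousOn_lineIn (α : E.FrameIndex) :
    ContinuousOn (E.lineIn α) (TotalSpace.proj ⁻¹' (E.triv α.1).baseSet) := by
  have h := (projTrivialization ℂ E.F E.E (E.triv α.1)).continuousOn
  rw [projTrivialization_source] at h
  have : E.lineIn α = fun m ↦ homeomorphOfContinuousLinearEquiv α.2
      (projTrivialization ℂ E.F E.E (E.triv α.1) m).2 := funext (lineIn_eq_homeomorph α)
  rw [this]
  exact (homeomorphOfContinuousLinearEquiv α.2).continuous.comp_continuousOn h.snd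

/-! ### The fixed coordinate functional and the chart data -/

variable (E)

/-- A basis of the model fibre indexed by `Fin (rank E)`. [folklore] -/
def stdBasis : Module.Basis (Fin E.rank) ℂ E.F := Module.finBasis ℂ E.F

/-- The coordinate functionals of `stdBasis`, as continuous linear maps. [folklore] -/
def coordFun (k : Fin E.rank) : E.F →L[ℂ] ℂ := LinearMap.toContinuousLinearMap (E.stdBasis.coord k)

/-- The coordinate functional is the coordinate. [folklore] -/
@[simp]
theorem coordFun_apply (k : Fin E.rank) (x : E.F) : E.coordFun k x = E.stdBasis.repr x k := rfl

/-- `x_k(b_k) = 1`. [folklore] -/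
theorem coordFun_basis_self (k : Fin E.rank) : E.coordFun k (E.stdBasis k) = 1 := by
  simp

/-- `x_k(b_j) = 0` for `j ≠ k`. [folklore] -/
theorem coordFun_basis_ne {k j : Fin E.rank} (h : j ≠ k) : E.coordFun k (E.stdBasis j) = 0 := by
  simp [h]

/-- The coordinate swap `x_k ↔ x_{k₀}` as a linear automorphism of `F`. [folklore] -/
def swapFrame (k₀ k : Fin E.rank) : E.F ≃L[ℂ] E.F :=
  (E.stdBasis.equiv E.stdBasis (Equiv.swap k k₀)).toContinuousLinearEquiv

/-- After the swap, the `k₀`-th coordinate is the old `k`-th coordinate. [folklore] -/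
theorem coordFun_swapFrame (k₀ k : Fin E.rank) (x : E.F) :
    E.coordFun k₀ (E.swapFrame k₀ k x) = E.coordFun k x := by
  have key : ((E.coordFun k₀ : E.F →ₗ[ℂ] ℂ).comp
      (E.stdBasis.equiv E.stdBasis (Equiv.swap k k₀) : E.F →ₗ[ℂ] E.F)) = (E.coordFun k : E.F →ₗ[ℂ] ℂ) := by
    refine E.stdBasis.ext fun j ↦ ?_
    simp only [LinearMap.coe_comp, comp_apply, LinearEquiv.coe_coe, Module.Basis.equiv_apply,
      ContinuousLinearMap.coe_coe, coordFun_apply, Module.Basis.repr_self]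
    by_cases hj : j = k
    · subst hj
      simp
    · have hσ : Equiv.swap k k₀ j ≠ k₀ := fun h ↦ by
        have h' := congrArg (Equiv.swap k k₀) h
        rw [Equiv.swap_apply_self, Equiv.swap_apply_right] at h'
        exact hj h'
      rw [Finsupp.single_apply, Finsupp.single_apply, if_neg hσ, if_neg hj]
  exact LinearMap.congr_fun key x

variable (k₀ : Fin E.rank)

/-- The fixed chart functional `φ₀ = x_{k₀}` as an element of the dual. [folklore] -/
abbrev φ₀ : Module.Dual ℂ E.F := (E.coordFun k₀ : E.F →ₗ[ℂ] ℂ)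

/-- **The normalised representative `v_α(m)`** of the line `ℓ_α(m)` in the chart `φ₀ ≠ 0`
(`φ₀ (v_α m) = 1` there). [cite: HusemollerFibreBundles1994, Ch. 17 §2] -/
def lineRep (α : E.FrameIndex) (m : E.Proj) : E.F := affineRep (E.φ₀ k₀) (E.lineIn α m)

/-- The chart domain of the frame `α = (i, A)`: `b ∈ U_i` and `φ₀(ℓ_α) ≠ 0`. [folklore] -/
def chartSet (α : E.FrameIndex) : Set E.Proj :=
  {m | m.proj ∈ (E.triv α.1).baseSet ∧ E.lineIn α m ∈ chartDomain (E.φ₀ k₀)}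

variable {E k₀}

/-- Membership in the chart domain, unfolded. [folklore] -/
theorem mem_chartSet_iff {α : E.FrameIndex} {m : E.Proj} :
    m ∈ E.chartSet k₀ α ↔ m.proj ∈ (E.triv α.1).baseSet ∧ E.lineIn α m ∈ chartDomain (E.φ₀ k₀) :=
  Iff.rfl

/-- On its chart, `φ₀ (v_α m) = 1`. [folklore] -/
theorem φ₀_lineRep {α : E.FrameIndex} {m : E.Proj} (hm : m ∈ E.chartSet k₀ α) :
    E.coordFun k₀ (E.lineRep k₀ α m) = 1 :=
  apply_affineRep (E.φ₀ k₀) hm.2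

/-- On its chart, `v_α m ≠ 0`. [folklore] -/
theorem lineRep_ne_zero {α : E.FrameIndex} {m : E.Proj} (hm : m ∈ E.chartSet k₀ α) :
    E.lineRep k₀ α m ≠ 0 :=
  affineRep_ne_zero (E.φ₀ k₀) hm.2

/-- On its chart, `v_α m` spans the line: `[v_α m] = ℓ_α m`. [folklore] -/
theorem mk_lineRep {α : E.FrameIndex} {m : E.Proj} (hm : m ∈ E.chartSet k₀ α) :
    Projectivization.mk ℂ (E.lineRep k₀ α m) (lineRep_ne_zero hm) = E.lineIn α m :=
  mk_affineRep (E.φ₀ k₀) hm.2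

variable (k₀) in
/-- **The transition scalar** `c_{αβ}(m) = φ₀ (G_{αβ} v_α)`. [cite: HusemollerFibreBundles1994, Ch. 17 §2] -/
def transScalar (α β : E.FrameIndex) (m : E.Proj) : ℂ :=
  E.coordFun k₀ (E.frameChange α β m.proj (E.lineRep k₀ α m))

/-- **Transfer of representatives**: `G_{αβ} v_α = c_{αβ} • v_β` on the overlap, with
`c_{αβ} ≠ 0`. [folklore] -/
theorem frameChange_lineRep {α β : E.FrameIndex} {m : E.Proj} (hα : m ∈ E.chartSet k₀ α)
    (hβ : m ∈ E.chartSet k₀ β) :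
    E.transScalar k₀ α β m ≠ 0 ∧
      E.frameChange α β m.proj (E.lineRep k₀ α m) = E.transScalar k₀ α β m • E.lineRep k₀ β m := by
  have hG0 : E.frameChange α β m.proj (E.lineRep k₀ α m) ≠ 0 := fun h ↦
    lineRep_ne_zero hα ((E.frameChange α β m.proj).injective (by rw [h, map_zero]))
  have hline : E.lineIn β m = Projectivization.mk ℂ _ hG0 := by
    rw [lineIn_eq_map ⟨hα.1, hβ.1⟩]
    conv_lhs => rw [← mk_lineRep hα]
    rw [Projectivization.map_mk]
    rfl
  have hc : E.transScalar k₀ α β m ≠ 0 := by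
    have h2 := hβ.2
    rw [hline, mk_mem_chartDomain_iff] at h2
    exact h2
  refine ⟨hc, ?_⟩
  have hrep : E.lineRep k₀ β m = (E.transScalar k₀ α β m)⁻¹ • E.frameChange α β m.proj (E.lineRep k₀ α m) := by
    rw [lineRep, hline, affineRep_mk]
    rfl
  rw [hrep, smul_smul, mul_inv_cancel₀ hc, one_smul]

/-- The transition scalars form a cocycle: `c_{βγ} c_{αβ} = c_{αγ}`. [folklore] -/
theorem transScalar_cocycle {α β γ : E.FrameIndex} {m : E.Proj} (hα : m ∈ E.chartSet k₀ α)
    (hβ : m ∈ E.chartSet k₀ β) (hγ : m ∈ E.chartSet k₀ γ) :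
    E.transScalar k₀ β γ m * E.transScalar k₀ α β m = E.transScalar k₀ α γ m := by
  obtain ⟨-, h1⟩ := frameChange_lineRep hα hβ
  have h2 : E.frameChange α γ m.proj (E.lineRep k₀ α m) =
      E.transScalar k₀ α β m • E.frameChange β γ m.proj (E.lineRep k₀ β m) := by
    rw [← frameChange_comp hα.1 hβ.1 hγ.1, h1, map_smul]
  simp only [transScalar] at h2 ⊢
  rw [h2, map_smul, smul_eq_mul, mul_comm]

/-- `c_{αα} = 1`. [folklore] -/
theorem transScalar_self {α : E.FrameIndex} {m : E.Proj} (hα : m ∈ E.chartSet k₀ α) :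
    E.transScalar k₀ α α m = 1 := by
  rw [transScalar, frameChange_self hα.1, φ₀_lineRep hα]

/-- The chart domains are open. [folklore] -/
theorem isOpen_chartSet (α : E.FrameIndex) : IsOpen (E.chartSet k₀ α) := by
  have hU : IsOpen (chartDomain (E.φ₀ k₀) : Set (ℙ ℂ E.F)) :=
    isOpen_chartDomain _ (E.coordFun k₀).continuous
  exact (continuousOn_lineIn α).isOpen_inter_preimage
    ((E.triv α.1).open_baseSet.preimage (continuous_projProj ℂ E.F E.E)) hU

/-- `v_α` is continuous on the chart of `α`. [folklore] -/
theorem continuousOn_lineRep (α : E.FrameIndex) : ContinuousOn (E.lineRep k₀ α) (E.chartSet k₀ α) :=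
  (continuousOn_affineRep (E.φ₀ k₀) (E.coordFun k₀).continuous).comp
    ((continuousOn_lineIn α).mono fun _ hm ↦ hm.1) fun _ hm ↦ hm.2

/-- The transition scalar is continuous on the overlap. [folklore] -/
theorem continuousOn_transScalar (α β : E.FrameIndex) :
    ContinuousOn (E.transScalar k₀ α β) (E.chartSet k₀ α ∩ E.chartSet k₀ β) := by
  refine (E.coordFun k₀).continuous.comp_continuousOn ?_
  exact ContinuousOn.clm_apply
    ((continuousOn_frameChange α β).comp (continuous_projProj ℂ E.F E.E).continuousOn
      fun m hm ↦ ⟨hm.1.1, hm.2.1⟩)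
    ((continuousOn_lineRep α).mono inter_subset_left)

/-! ### Every point lies in an adapted chart -/

/-- A nonzero vector has a nonzero coordinate. [folklore] -/
theorem exists_coordFun_ne_zero {x : E.F} (hx : x ≠ 0) : ∃ k, E.coordFun k x ≠ 0 := by
  by_contra h
  push Not at h
  exact hx (E.stdBasis.ext_elem fun k ↦ by simpa using h k)

variable (E k₀)

/-- A coordinate `k` not vanishing on the line of `m` in the canonical frame at `q m`. [folklore] -/
def coordAt (m : E.Proj) : Fin E.rank :=
  Classical.choose (exists_coordFun_ne_zero (E := E)
    (Projectivization.rep_nonzero (E.lineIn (m.proj, ContinuousLinearEquiv.refl ℂ E.F) m)))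

/-- The chosen coordinate does not vanish on the line. [folklore] -/
theorem coordFun_coordAt_ne_zero (m : E.Proj) :
    E.coordFun (E.coordAt m) (E.lineIn (m.proj, ContinuousLinearEquiv.refl ℂ E.F) m).rep ≠ 0 :=
  Classical.choose_spec (exists_coordFun_ne_zero (E := E)
    (Projectivization.rep_nonzero (E.lineIn (m.proj, ContinuousLinearEquiv.refl ℂ E.F) m)))

/-- **The adapted chart at `m`**: the canonical trivialisation at `q m` followed by the swap moving
a nonvanishing coordinate of the line to `k₀`. [folklore] -/
def chartAt (m : E.Proj) : E.FrameIndex := (m.proj, E.swapFrame k₀ (E.coordAt m))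

/-- Every point lies in its adapted chart. [folklore] -/
theorem mem_chartSet_chartAt (m : E.Proj) : m ∈ E.chartSet k₀ (E.chartAt k₀ m) := by
  refine ⟨FiberBundle.mem_baseSet_trivializationAt E.F E.E m.proj, ?_⟩
  have hb : m.proj ∈ (E.triv m.proj).baseSet ∩ (E.triv m.proj).baseSet :=
    ⟨FiberBundle.mem_baseSet_trivializationAt E.F E.E m.proj,
      FiberBundle.mem_baseSet_trivializationAt E.F E.E m.proj⟩
  have h := lineIn_eq_map (α := (m.proj, ContinuousLinearEquiv.refl ℂ E.F)) (β := E.chartAt k₀ m) hb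
  rw [chartAt] at h ⊢
  rw [h]
  set ℓ := E.lineIn (m.proj, ContinuousLinearEquiv.refl ℂ E.F) m with hℓ
  rw [← ℓ.mk_rep, Projectivization.map_mk, mk_mem_chartDomain_iff]
  change E.coordFun k₀ (E.frameChange (m.proj, ContinuousLinearEquiv.refl ℂ E.F)
    (m.proj, E.swapFrame k₀ (E.coordAt m)) m.proj ℓ.rep) ≠ 0
  have : E.frameChange (m.proj, ContinuousLinearEquiv.refl ℂ E.F)
      (m.proj, E.swapFrame k₀ (E.coordAt m)) m.proj ℓ.rep = E.swapFrame k₀ (E.coordAt m) ℓ.rep := by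
    have h1 := frameChange_self (E := E) (α := (m.proj, ContinuousLinearEquiv.refl ℂ E.F)) hb.1 ℓ.rep
    simp only [frameChange, ContinuousLinearEquiv.trans_apply, ContinuousLinearEquiv.refl_symm,
      ContinuousLinearEquiv.refl_apply] at h1 ⊢
    rw [h1]
  rw [this, coordFun_swapFrame]
  exact E.coordFun_coordAt_ne_zero m

/-! ### The line subbundle `λ` -/

/-- **The line subbundle `λ_ξ ⊆ q*ξ` as a vector bundle core over `P(E)`** (model fibre `ℂ`; in
the chart `α` the coordinate of `x ∈ ℓ` is `φ₀(x_α)`, so the cocycle is multiplication by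
`c_{αβ} = φ₀(G_{αβ} v_α)`). [cite: HusemollerFibreBundles1994, Ch. 17 §2, §5 Prop. 5.2] -/
def lineCore : VectorBundleCore ℂ E.Proj ℂ E.FrameIndex where
  baseSet := E.chartSet k₀
  isOpen_baseSet := isOpen_chartSet
  indexAt := E.chartAt k₀
  mem_baseSet_at := E.mem_chartSet_chartAt k₀
  coordChange α β m := E.transScalar k₀ α β m • ContinuousLinearMap.id ℂ ℂ
  coordChange_self α m hm c := by
    simp [transScalar_self hm]
  continuousOn_coordChange α β := (continuousOn_transScalar α β).smul continuousOn_const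
  coordChange_comp α β γ m hm c := by
    change E.transScalar k₀ β γ m • (E.transScalar k₀ α β m • c) = E.transScalar k₀ α γ m • c
    rw [smul_smul, transScalar_cocycle hm.1.1 hm.1.2 hm.2]

/-- The base sets of `λ` are the chart domains. [folklore] -/
@[simp]
theorem lineCore_baseSet (α : E.FrameIndex) : (E.lineCore k₀).baseSet α = E.chartSet k₀ α := rfl

/-- The distinguished chart of `λ` at `m` is the adapted chart. [folklore] -/
@[simp]
theorem lineCore_indexAt (m : E.Proj) : (E.lineCore k₀).indexAt m = E.chartAt k₀ m := rfl

/-- The cocycle of `λ` is multiplication by the transition scalar. [folklore] -/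
theorem lineCore_coordChange_apply (α β : E.FrameIndex) (m : E.Proj) (c : ℂ) :
    (E.lineCore k₀).coordChange α β m c = E.transScalar k₀ α β m * c := rfl

/-- **The line subbundle `λ` of `q*E` over `P(E)`** as a complex vector bundle (rank `1`).
[cite: HusemollerFibreBundles1994, Ch. 17 §5 Prop. 5.2] -/
def lineBundle : ComplexVectorBundle.{0, 0} E.Proj := ofCore (E.lineCore k₀)

/-- `λ` is a line bundle. [folklore] -/
@[simp]
theorem rank_lineBundle : (E.lineBundle k₀).rank = 1 := by
  rw [lineBundle, rank_ofCore, Module.finrank_self]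

/-! ### The quotient bundle `σ = q*E / λ` -/

/-- The model fibre of `σ`: the hyperplane `F' = ker φ₀`. [folklore] -/
abbrev quotModel : Submodule ℂ E.F := LinearMap.ker (E.coordFun k₀).toLinearMap

/-- The projection `Q_v x = x - φ₀(x) v` of `F` along `v` (onto `ker φ₀` when `φ₀ v = 1`).
[folklore] -/
def projVec (v : E.F) : E.F →L[ℂ] E.F := ContinuousLinearMap.id ℂ E.F - (E.coordFun k₀).smulRight v

/-- `Q_v x = x - φ₀(x) v`. [folklore] -/
@[simp]
theorem projVec_apply (v x : E.F) : E.projVec k₀ v x = x - E.coordFun k₀ x • v := rfl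

/-- The fixed projection onto `ker φ₀` along the basis vector `u₀ = stdBasis k₀`. [folklore] -/
def projFix : E.F →L[ℂ] E.quotModel k₀ :=
  (E.projVec k₀ (E.stdBasis k₀)).codRestrict (E.quotModel k₀) fun x ↦ by
    rw [LinearMap.mem_ker, ContinuousLinearMap.coe_coe, projVec_apply, map_sub, map_smul,
      coordFun_basis_self, smul_eq_mul, mul_one, sub_self]

/-- The fixed projection, as a vector of `F`. [folklore] -/
@[simp]
theorem coe_projFix_apply (y : E.F) :
    (E.projFix k₀ y : E.F) = y - E.coordFun k₀ y • E.stdBasis k₀ := rfl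

/-- The fixed projection is the identity on `ker φ₀`. [folklore] -/
theorem projFix_apply_of_mem {y : E.F} (hy : E.coordFun k₀ y = 0) : (E.projFix k₀ y : E.F) = y := by
  rw [coe_projFix_apply, hy, zero_smul, sub_zero]

/-- **The projection along `v` onto the model hyperplane**, `x ↦ x - φ₀(x) v ∈ ker φ₀` (for
`φ₀ v = 1`), written as `projFix ∘ Q_v` so that it depends continuously on `v`. [folklore] -/
def projAlong (v : E.F) : E.F →L[ℂ] E.quotModel k₀ := (E.projFix k₀).comp (E.projVec k₀ v)

/-- For `φ₀ v = 1`, `projAlong v x = x - φ₀(x) v`. [folklore] -/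
theorem projAlong_apply {v : E.F} (hv : E.coordFun k₀ v = 1) (x : E.F) :
    (E.projAlong k₀ v x : E.F) = x - E.coordFun k₀ x • v := by
  rw [projAlong, ContinuousLinearMap.comp_apply, projFix_apply_of_mem]
  · rfl
  · rw [projVec_apply, map_sub, map_smul, hv, smul_eq_mul, mul_one, sub_self]

/-- `projAlong v` depends continuously on `v` (operator norm). [folklore] -/
theorem continuous_projAlong : Continuous fun v ↦ E.projAlong k₀ v := by
  have h1 : Continuous fun v : E.F ↦ E.projVec k₀ v :=
    continuous_const.sub (ContinuousLinearMap.smulRightL ℂ E.F E.F (E.coordFun k₀)).continuous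
  exact (continuous_const (y := E.projFix k₀)).clm_comp h1

/-- The cocycle of `σ`: `y ↦ G_{αβ} y - φ₀(G_{αβ} y) v_β`, the map induced by `G_{αβ}` on `F/ℓ`
read in the complements `ker φ₀`. [cite: HusemollerFibreBundles1994, Ch. 17 §5 Prop. 5.2] -/
def quotCoordChange (α β : E.FrameIndex) (m : E.Proj) : E.quotModel k₀ →L[ℂ] E.quotModel k₀ :=
  (E.projAlong k₀ (E.lineRep k₀ β m)).comp
    ((E.frameChange α β m.proj : E.F →L[ℂ] E.F).comp (E.quotModel k₀).subtypeL)

/-- The cocycle of `σ` on vectors: `y ↦ G y - φ₀(G y) v_β`. [folklore] -/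
theorem quotCoordChange_apply {α β : E.FrameIndex} {m : E.Proj} (hβ : m ∈ E.chartSet k₀ β)
    (y : E.quotModel k₀) :
    (E.quotCoordChange k₀ α β m y : E.F) = E.frameChange α β m.proj y -
      E.coordFun k₀ (E.frameChange α β m.proj y) • E.lineRep k₀ β m := by
  rw [quotCoordChange, ContinuousLinearMap.comp_apply, ContinuousLinearMap.comp_apply,
    projAlong_apply (hv := φ₀_lineRep hβ)]
  rfl

/-- `projAlong v_β` kills the line: `v_β - φ₀(v_β) v_β = 0`. [folklore] -/
theorem projAlong_lineRep {β : E.FrameIndex} {m : E.Proj} (hβ : m ∈ E.chartSet k₀ β) :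
    E.projAlong k₀ (E.lineRep k₀ β m) (E.lineRep k₀ β m) = 0 := by
  apply Subtype.ext
  rw [projAlong_apply (hv := φ₀_lineRep hβ), φ₀_lineRep hβ, one_smul, sub_self]
  rfl

/-- **The quotient bundle `σ = q*E/λ` as a vector bundle core over `P(E)`** (model fibre
`ker φ₀ ≅ ℂⁿ⁻¹`). [cite: HusemollerFibreBundles1994, Ch. 17 §5 Prop. 5.2] -/
def quotCore : VectorBundleCore ℂ E.Proj (E.quotModel k₀) E.FrameIndex where
  baseSet := E.chartSet k₀
  isOpen_baseSet := isOpen_chartSet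
  indexAt := E.chartAt k₀
  mem_baseSet_at := E.mem_chartSet_chartAt k₀
  coordChange := E.quotCoordChange k₀
  coordChange_self α m hm y := by
    apply Subtype.ext
    rw [quotCoordChange_apply (hβ := hm), frameChange_self hm.1]
    have hy : E.coordFun k₀ (y : E.F) = 0 := y.2
    rw [hy, zero_smul, sub_zero]
  continuousOn_coordChange α β := by
    refine ContinuousOn.clm_comp ?_ ?_
    · exact (E.continuous_projAlong k₀).comp_continuousOn
        ((continuousOn_lineRep β).mono inter_subset_right)
    · exact ((continuousOn_frameChange α β).comp (continuous_projProj ℂ E.F E.E).continuousOn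
        fun m hm ↦ ⟨hm.1.1, hm.2.1⟩).clm_comp continuousOn_const
  coordChange_comp α β γ m hm y := by
    obtain ⟨⟨hα, hβ⟩, hγ⟩ := hm
    apply Subtype.ext
    rw [quotCoordChange_apply (hβ := hγ), quotCoordChange_apply (hβ := hγ), quotCoordChange_apply (hβ := hβ),
      map_sub, map_smul, (frameChange_lineRep hβ hγ).2, frameChange_comp hα.1 hβ.1 hγ.1,
      map_sub, map_smul, map_smul, φ₀_lineRep hγ]
    simp only [smul_eq_mul, mul_one, sub_smul, smul_smul]
    abel

/-- The base sets of `σ` are the chart domains. [folklore] -/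
@[simp]
theorem quotCore_baseSet (α : E.FrameIndex) : (E.quotCore k₀).baseSet α = E.chartSet k₀ α := rfl

/-- The distinguished chart of `σ` at `m` is the adapted chart. [folklore] -/
@[simp]
theorem quotCore_indexAt (m : E.Proj) : (E.quotCore k₀).indexAt m = E.chartAt k₀ m := rfl

/-- `dim ker φ₀ = rank E - 1`. [folklore] -/
theorem finrank_quotModel : Module.finrank ℂ (E.quotModel k₀) = E.rank - 1 := by
  have hsurj : Function.Surjective (E.coordFun k₀).toLinearMap := fun c ↦
    ⟨c • E.stdBasis k₀, by simp⟩
  have h := (E.coordFun k₀).toLinearMap.finrank_range_add_finrank_ker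
  rw [LinearMap.range_eq_top.2 hsurj, finrank_top, Module.finrank_self] at h
  change Module.finrank ℂ (LinearMap.ker (E.coordFun k₀).toLinearMap) = Module.finrank ℂ E.F - 1
  omega

/-- **The quotient bundle `σ = q*E/λ` over `P(E)`** as a complex vector bundle, of rank
`rank E - 1`. [cite: HusemollerFibreBundles1994, Ch. 17 §5 Prop. 5.2] -/
def quotBundle : ComplexVectorBundle.{0, 0} E.Proj := ofCore (E.quotCore k₀)

/-- `σ` has rank `rank E - 1`. [folklore] -/
@[simp]
theorem rank_quotBundle : (E.quotBundle k₀).rank = E.rank - 1 := by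
  rw [quotBundle, rank_ofCore, finrank_quotModel]

end ComplexVectorBundle

end Literature.AlgebraicTopology.CharacteristicClasses
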